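import Mathlib
import Literature.RingTheory.MvPolynomial.GeomComponentCount
import Literature.RingTheory.Localization.MinimalPrimesLocalization
import HarnessLib

/-!
# The geometric number of components does not increase along dominant maps

Topic `Literature/RingTheory/MvPolynomial`, companion of `GeomComponentCount.lean`
(`Literature.RingTheory.MvPolynomial.geomComponentCount 𝔭 = #` minimal primes over `𝔭 k̄[X]`).

Let `ψ : k[X_σ] → k[X_τ]` be a homomorphism of `k`-algebras (a morphism `𝔸^τ → 𝔸^σ`), `𝔭` an
ideal of `k[X_τ]` and `𝔮 = ψ⁻¹(𝔭)` (so `V(𝔮)` is the closure of the image of `V(𝔭)`, and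
`k[X_σ]/𝔮 ↪ k[X_τ]/𝔭`). Then for every extension field `K` of `k`

  `#(minimal primes over 𝔮 K[X_σ]) ≤ #(minimal primes over 𝔭 K[X_τ])`

(`ncard_minimalPrimes_map_comap_le`), in particular
`geomComponentCount 𝔮 ≤ geomComponentCount 𝔭` (`geomComponentCount_comap_le`): a dominant
`k`-morphism does not increase the geometric number of irreducible components (every component of
the target is dominated by a component of the source). No hypothesis on `k`, `𝔭` or `ψ`; only
`τ` finite (so that `K[X_τ]` is Noetherian).

## Proof

* `minimalPrimes_subset_image_comap_of_injective` — for an INJECTIVE ring homomorphism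
  `f : R → S` with `S` having finitely many minimal primes, every minimal prime of `R` is the
  contraction of a minimal prime of `S`: `nil R = f⁻¹(nil S) = ⋂ f⁻¹(Pᵢ)` over the finitely many
  minimal primes `Pᵢ` of `S`, so a minimal prime `p ⊇ nil R` contains some prime `f⁻¹(Pᵢ)` and
  equals it. Hence `#minimal primes of R ≤ #minimal primes of S`
  (`ncard_minimalPrimes_le_of_injective`).
* The injection `k[X_σ]/𝔮 ↪ k[X_τ]/𝔭` stays injective after `K ⊗ₖ −` (`K` is flat over the
  field `k`), and `K ⊗ₖ k[X]/I ≅ K[X]/I K[X]`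
  (`Literature.FieldTheory.Regular.exists_algEquiv_quotient_map_tensor`), giving an injective ring
  homomorphism `K[X_σ]/𝔮K ↪ K[X_τ]/𝔭K` (`exists_injective_quotient_map_comap`).
* Minimal primes over `I` = minimal primes of `R/I`
  (`Literature.RingTheory.Localization.ncard_minimalPrimes_quotient`).

## Use

Step (C) of a Kronecker/geometric resolution (route `ValiantsHypothesis/LangWeilTransfer`, item
`TameResolution`): if `Q ∈ k[T, U]` generates the kernel of the substitution
`k[T, U] → k[Y]/𝔭`, `T ↦` Noether coordinates, `U ↦` a linear form, then
`#geometric factors of Q ≤ #geometric components of V(𝔭)` — with no inverse parametrisation and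
for any number of components (`geomComponentCount_span_singleton_le_of_comap_eq`).

## References

* U. Görtz, T. Wedhorn, *Algebraic Geometry I: Schemes*, 2nd ed. (2020): Cor. 2.11 (`ᵃφ` is
  dominant iff `ker φ` is nil), Exercise 10.1 (a quasi-compact morphism is dominant iff every
  maximal point of the target is the image of a maximal point of the source), Cor. 5.45
  (`X_K → X` surjective and open; components under base field extension), Rem. 5.55 (geometric
  number of irreducible components). [GortzWedhorn2020]
* M. F. Atiyah, I. G. Macdonald, *Introduction to Commutative Algebra* (1969), Prop. 1.8
  (nilradical = intersection of the primes), Prop. 1.11 (prime avoidance), Ch. 4.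
  [AtiyahMacdonald1969]
-/

noncomputable section

open MvPolynomial
open scoped TensorProduct

namespace Literature.RingTheory.MvPolynomial

/-! ### Minimal primes along an injective ring homomorphism -/

section Injective

variable {R S : Type*} [CommRing R] [CommRing S]

/-- **Every minimal prime downstairs is a contraction of a minimal prime upstairs.** For an
injective ring homomorphism `f : R → S` such that `S` has finitely many minimal primes,
`minimalPrimes R ⊆ f⁻¹(minimalPrimes S)`: the nilradical of `R` is `f⁻¹` of the nilradical of
`S`, which is the (finite) intersection of the minimal primes `Pᵢ` of `S`; a minimal prime `p` of
`R` contains `⋂ f⁻¹(Pᵢ)`, hence some `f⁻¹(Pᵢ)` (prime avoidance), hence equals it by minimality.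
Geometrically (Görtz–Wedhorn Exercise 10.1 (i) ⇒ (iii) with Cor. 2.11: `ᵃf` is dominant iff
`ker f` is nil, and then every maximal point of `Spec R` is the image of a maximal point of
`Spec S`): for a dominant morphism every irreducible component of the target is dominated by an
irreducible component of the source. Stated here in the case of finitely many minimal primes
upstairs, which is all that is used. -- TODO(general form): no finiteness hypothesis (Zorn).
[cite: GortzWedhorn2020, Exercise 10.1 and Cor. 2.11] -/
theorem minimalPrimes_subset_image_comap_of_injective (f : R →+* S)
    (hf : Function.Injective f) (hfin : (minimalPrimes S).Finite) :
    minimalPrimes R ⊆ Ideal.comap f '' minimalPrimes S := by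
  classical
  intro p hp
  have hpprime : p.IsPrime := hp.1.1
  -- the finite infimum of the contracted minimal primes lies in `p`
  have hle : hfin.toFinset.inf (fun P => Ideal.comap f P) ≤ p := by
    intro x hx
    -- `x` lies in every contracted minimal prime, so `f x` is nilpotent
    have hx' : f x ∈ nilradical S := by
      rw [nilradical, ← Ideal.sInf_minimalPrimes, Submodule.mem_sInf]
      intro P hP
      have hxP : x ∈ hfin.toFinset.inf (fun P => Ideal.comap f P) := hx
      rw [Submodule.mem_finsetInf] at hxP
      exact hxP P (hfin.mem_toFinset.mpr hP)
    have hxn : IsNilpotent x := (IsNilpotent.map_iff hf).mp hx'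
    exact nilradical_le_prime p hxn
  obtain ⟨P, hPmem, hPle⟩ := (Ideal.IsPrime.inf_le' hpprime).mp hle
  have hP : P ∈ minimalPrimes S := hfin.mem_toFinset.mp hPmem
  haveI : P.IsPrime := hP.1.1
  refine ⟨P, hP, le_antisymm hPle ?_⟩
  exact hp.2 ⟨Ideal.comap_isPrime f P, bot_le⟩ hPle

/-- Hence **an injective ring homomorphism into a ring with finitely many minimal primes does not
increase the number of minimal primes**: `#minimalPrimes R ≤ #minimalPrimes S` (the surjection
of Görtz–Wedhorn Exercise 10.1 (iii) from (a subset of) the maximal points of `Spec S` onto those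
of `Spec R`). [cite: GortzWedhorn2020, Exercise 10.1 and Cor. 2.11] -/
theorem ncard_minimalPrimes_le_of_injective (f : R →+* S) (hf : Function.Injective f)
    (hfin : (minimalPrimes S).Finite) :
    (minimalPrimes R).ncard ≤ (minimalPrimes S).ncard :=
  (Set.ncard_le_ncard (minimalPrimes_subset_image_comap_of_injective f hf hfin) (hfin.image _)).trans
    (Set.ncard_image_le hfin)

/-- In the same situation `R` itself has finitely many minimal primes (image of a finite set under
the surjection of Görtz–Wedhorn Exercise 10.1 (iii)).
[cite: GortzWedhorn2020, Exercise 10.1 and Cor. 2.11] -/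
theorem finite_minimalPrimes_of_injective (f : R →+* S) (hf : Function.Injective f)
    (hfin : (minimalPrimes S).Finite) : (minimalPrimes R).Finite :=
  (hfin.image _).subset (minimalPrimes_subset_image_comap_of_injective f hf hfin)

end Injective

/-! ### Base change of the injection `k[X_σ]/ψ⁻¹(𝔭) ↪ k[X_τ]/𝔭` -/

section BaseChange

variable {k : Type*} [Field k] {σ τ : Type*}

/-- **`K[X_σ]/𝔮K ↪ K[X_τ]/𝔭K` for `𝔮 = ψ⁻¹(𝔭)`.** The injection `k[X_σ]/𝔮 ↪ k[X_τ]/𝔭` induced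
by a `k`-algebra map `ψ` with `𝔮 = ψ⁻¹(𝔭)` stays injective after the flat base change `K ⊗ₖ −`,
and `K ⊗ₖ k[X]/I ≅ K[X]/IK[X]`; so there is an injective ring homomorphism between the extended
quotients — i.e. the dominant morphism `V(𝔭) → V(𝔮)` stays dominant after the base change
`Spec K → Spec k` (Görtz–Wedhorn Cor. 5.45 (1): `X_K → X` is surjective, so dominance is preserved;
here proved directly by flatness). [cite: GortzWedhorn2020, Cor. 5.45 and Cor. 2.11] -/
theorem exists_injective_quotient_map_comap (K : Type*) [Field K] [Algebra k K]
    (𝔭 : Ideal (MvPolynomial τ k)) (ψ : MvPolynomial σ k →ₐ[k] MvPolynomial τ k) :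
    ∃ f : (MvPolynomial σ K ⧸ (𝔭.comap ψ).map (MvPolynomial.map (algebraMap k K))) →+*
        (MvPolynomial τ K ⧸ 𝔭.map (MvPolynomial.map (algebraMap k K))),
      Function.Injective f := by
  classical
  set 𝔮 : Ideal (MvPolynomial σ k) := 𝔭.comap ψ with h𝔮
  -- the injection over `k`
  let ψbar : (MvPolynomial σ k ⧸ 𝔮) →ₐ[k] (MvPolynomial τ k ⧸ 𝔭) :=
    Ideal.quotientMapₐ 𝔭 ψ le_rfl
  have hψbar : Function.Injective ψbar := by
    rw [injective_iff_map_eq_zero]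
    intro a ha
    obtain ⟨x, rfl⟩ := Ideal.Quotient.mk_surjective a
    rw [Ideal.quotient_map_mkₐ, Ideal.Quotient.mkₐ_eq_mk, Ideal.Quotient.eq_zero_iff_mem] at ha
    exact Ideal.Quotient.eq_zero_iff_mem.mpr (Ideal.mem_comap.mpr ha)
  -- its base change to `K` is injective (`K` is flat over `k`)
  let T : K ⊗[k] (MvPolynomial σ k ⧸ 𝔮) →ₐ[K] K ⊗[k] (MvPolynomial τ k ⧸ 𝔭) :=
    Algebra.TensorProduct.map (AlgHom.id K K) ψbar
  have hT : Function.Injective T := by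
    have h1 : Function.Injective (LinearMap.lTensor K ψbar.toLinearMap) :=
      Module.Flat.lTensor_preserves_injective_linearMap _ hψbar
    have h2 : ⇑(LinearMap.lTensor K ψbar.toLinearMap) = ⇑T := by
      have h3 : LinearMap.lTensor K ψbar.toLinearMap = T.toLinearMap.restrictScalars k := by
        apply TensorProduct.ext'
        intro a b
        simp [T, LinearMap.lTensor_tmul]
      rw [h3]
      rfl
    rwa [h2] at h1
  -- transport along `K[X]/IK ≅ K ⊗ k[X]/I`
  obtain ⟨eσ, -⟩ := Literature.FieldTheory.Regular.exists_algEquiv_quotient_map_tensor (F' := K) 𝔮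
  obtain ⟨eτ, -⟩ := Literature.FieldTheory.Regular.exists_algEquiv_quotient_map_tensor (F' := K) 𝔭
  refine ⟨(eτ.symm.toAlgHom.comp (T.comp eσ.toAlgHom)).toRingHom, ?_⟩
  exact (eτ.symm.injective.comp (hT.comp eσ.injective) :
    Function.Injective (fun x => eτ.symm (T (eσ x))))

/-- **The number of minimal primes over `ψ⁻¹(𝔭) K[X_σ]` is at most the number over `𝔭 K[X_τ]`**,
for every `k`-algebra map `ψ : k[X_σ] → k[X_τ]`, every ideal `𝔭` of `k[X_τ]` (`τ` finite) and
every extension field `K/k`: the dominant `K`-morphism `V(𝔭)_K → V(𝔮)_K` hits every maximal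
point of its target (Görtz–Wedhorn Exercise 10.1), so the target has at most as many irreducible
components as the source. [cite: GortzWedhorn2020, Exercise 10.1 and Cor. 5.45] -/
theorem ncard_minimalPrimes_map_comap_le (K : Type*) [Field K] [Algebra k K] [Finite τ]
    (𝔭 : Ideal (MvPolynomial τ k)) (ψ : MvPolynomial σ k →ₐ[k] MvPolynomial τ k) :
    (((𝔭.comap ψ).map (MvPolynomial.map (algebraMap k K))).minimalPrimes).ncard ≤
      ((𝔭.map (MvPolynomial.map (algebraMap k K))).minimalPrimes).ncard := by
  obtain ⟨f, hf⟩ := exists_injective_quotient_map_comap K 𝔭 ψ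
  rw [Literature.RingTheory.Localization.ncard_minimalPrimes_quotient
      ((𝔭.comap ψ).map (MvPolynomial.map (algebraMap k K))),
    Literature.RingTheory.Localization.ncard_minimalPrimes_quotient
      (𝔭.map (MvPolynomial.map (algebraMap k K)))]
  exact ncard_minimalPrimes_le_of_injective f hf (minimalPrimes.finite_of_isNoetherianRing _)

/-- The extended ideal `ψ⁻¹(𝔭) K[X_σ]` has finitely many minimal primes as soon as `τ` is finite
(no finiteness of `σ` needed): they are contractions of the finitely many maximal points upstairs
(Görtz–Wedhorn Exercise 10.1 (iii)). [cite: GortzWedhorn2020, Exercise 10.1 and Cor. 5.45] -/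
theorem finite_minimalPrimes_map_comap (K : Type*) [Field K] [Algebra k K] [Finite τ]
    (𝔭 : Ideal (MvPolynomial τ k)) (ψ : MvPolynomial σ k →ₐ[k] MvPolynomial τ k) :
    (((𝔭.comap ψ).map (MvPolynomial.map (algebraMap k K))).minimalPrimes).Finite := by
  obtain ⟨f, hf⟩ := exists_injective_quotient_map_comap K 𝔭 ψ
  have h := finite_minimalPrimes_of_injective f hf (minimalPrimes.finite_of_isNoetherianRing _)
  rw [Ideal.minimalPrimes_eq_comap]
  exact h.image _

end BaseChange

/-! ### The geometric number of components -/

section Geometric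

variable {k : Type*} [Field k] {σ τ : Type*}

/-- **Dominant maps do not increase the geometric number of components.** For a `k`-algebra map
`ψ : k[X_σ] → k[X_τ]` and an ideal `𝔭 ⊆ k[X_τ]` (`τ` finite), the ideal `ψ⁻¹(𝔭)` of the closure
of the image of `V(𝔭)` has `geomComponentCount (ψ⁻¹ 𝔭) ≤ geomComponentCount 𝔭` (Görtz–Wedhorn
Rem. 5.55 for the notion; Exercise 10.1 for the surjection on maximal points after base change to
`k̄`). [cite: GortzWedhorn2020, Rem. 5.55 and Exercise 10.1] -/
theorem geomComponentCount_comap_le [Finite τ] (𝔭 : Ideal (MvPolynomial τ k))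
    (ψ : MvPolynomial σ k →ₐ[k] MvPolynomial τ k) :
    geomComponentCount (𝔭.comap ψ) ≤ geomComponentCount 𝔭 :=
  ncard_minimalPrimes_map_comap_le (AlgebraicClosure k) 𝔭 ψ

/-- The same for a substitution `ψ = aeval g` (`g : σ → k[X_τ]`), the form met in practice:
`geomComponentCount ((aeval g)⁻¹ 𝔭) ≤ geomComponentCount 𝔭`. [cite: GortzWedhorn2020, Rem. 5.55] -/
theorem geomComponentCount_comap_aeval_le [Finite τ] (𝔭 : Ideal (MvPolynomial τ k))
    (g : σ → MvPolynomial τ k) :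
    geomComponentCount (𝔭.comap (MvPolynomial.aeval g : MvPolynomial σ k →ₐ[k] MvPolynomial τ k)) ≤
      geomComponentCount 𝔭 :=
  geomComponentCount_comap_le 𝔭 _

/-- **Hypersurface models.** If `Q ∈ k[X_σ]` generates the kernel of `k[X_σ] → k[X_τ]/𝔭`
(`ψ⁻¹(𝔭) = (Q)`; e.g. `Q` the minimal polynomial of a primitive element over Noether
coordinates), then the number of geometric factors of `Q` — `geomComponentCount (Q)`, cf.
`geomComponentCount_span_singleton` — is at most the geometric number of components of `V(𝔭)`.
This is the component-count step of a geometric resolution, valid for any number of components.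
[cite: GortzWedhorn2020, Rem. 5.55] -/
theorem geomComponentCount_span_singleton_le_of_comap_eq [Finite τ] (𝔭 : Ideal (MvPolynomial τ k))
    (ψ : MvPolynomial σ k →ₐ[k] MvPolynomial τ k) (Q : MvPolynomial σ k)
    (hQ : 𝔭.comap ψ = Ideal.span {Q}) :
    geomComponentCount (Ideal.span {Q}) ≤ geomComponentCount 𝔭 := by
  rw [← hQ]
  exact geomComponentCount_comap_le 𝔭 ψ

/-- The route-facing spelling (route `ValiantsHypothesis/LangWeilTransfer`, item `TameResolution`,
with `k = ℚ`): the literal `ncard` terms. [cite: GortzWedhorn2020, Rem. 5.55] -/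
theorem ncard_minimalPrimes_span_singleton_le_of_comap_eq [Finite τ] (𝔭 : Ideal (MvPolynomial τ k))
    (ψ : MvPolynomial σ k →ₐ[k] MvPolynomial τ k) (Q : MvPolynomial σ k)
    (hQ : 𝔭.comap ψ = Ideal.span {Q}) :
    ((Ideal.map (MvPolynomial.map (algebraMap k (AlgebraicClosure k)))
        (Ideal.span {Q})).minimalPrimes).ncard ≤
      ((Ideal.map (MvPolynomial.map (algebraMap k (AlgebraicClosure k))) 𝔭).minimalPrimes).ncard :=
  geomComponentCount_span_singleton_le_of_comap_eq 𝔭 ψ Q hQ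

end Geometric

end Literature.RingTheory.MvPolynomial

end
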